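import Literature.Topology.FourManifolds.NonSeparatingSpheresGraph
import Literature.Topology.FourManifolds.SurgeredMappingTorus
import Mathlib.Geometry.Manifold.PartitionOfUnity
import HarnessLib

/-!
# Budney–Gabai Thm. 3.13: straightening the sphere over a tube about the dual circle

Fact seat of `Literature.Topology.FourManifolds.BudneyGabai2019_thm_3_13` (R. Budney, D. Gabai,
*Knotted 3-balls in `S⁴`*, arXiv:1912.09029, Thm. 3.13).  Third sentence of the printed proof
(p. 22): *"If we drill a neighbourhood of `S¹ × {*}` out of `S¹ × Sⁿ` we have constructed
`S¹ × Bⁿ`, and our non-separating sphere is converted to a reducing ball."*  After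
`NonSeparatingSpheresGraph.lean` the sphere `K = e(Sⁿ)` is, over a ball `B(p₀, r₁) ⊆ Sⁿ`, the graph
of a `C^∞` map `g : B(p₀, r₁) → S¹`.  Here we straighten that graph by a **shear**
`Θ(z, p) = (z · k(p)⁻¹, p)` of `S¹ × Sⁿ` (`k : Sⁿ → S¹` a `C^∞` extension of `g` from a smaller
closed ball, obtained from a local angle `A ∘ g` and a bump function), a fibre-preserving
self-diffeomorphism of `S¹ × Sⁿ` after which the sphere meets the closed tube
`S¹ × B̄(p₀, r)` exactly in the flat disc `{1} × B̄(p₀, r)`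
(`BudneyGabai2019_thm_3_13.exists_shear_straightening`).  Drilling the open tube then leaves a
properly embedded ball in `S¹ × (Sⁿ ∖ B(p₀, r)) ≅ S¹ × Bⁿ`.

Everything here is proved; no definition and no named fact is introduced.

## References

* R. Budney, D. Gabai, *Knotted 3-balls in `S⁴`*, arXiv:1912.09029 (v2), §3, proof of Thm. 3.13
  (p. 22). [BudneyGabai2019]
* M. W. Hirsch, *Differential Topology*, GTM 33 (1976), Ch. 2 §2 (bump functions, extension of
  smooth maps). [HirschDT1976]
-/

noncomputable section

open scoped Manifold ContDiff Topology Real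
open Set Function Metric Module Filter

namespace Literature.Topology.FourManifolds

namespace BudneyGabai2019_thm_3_13

variable {n : ℕ}

/-- A right inverse of `exp : ℝ → S¹` which is `C^∞` on an open neighbourhood of a prescribed
point `z₀ ∈ S¹` (the principal argument if `z₀ ≠ -1`, the argument slit at `1` otherwise).
[folklore] -/
theorem exists_angle_contMDiffOn (z₀ : Circle) :
    ∃ (A : Circle → ℝ) (U : Set Circle), IsOpen U ∧ z₀ ∈ U ∧
      ContMDiffOn (𝓡 1) 𝓘(ℝ, ℝ) ∞ A U ∧ ∀ z, Circle.exp (A z) = z := by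
  rcases mem_slitPlane_or_neg_mem_slitPlane z₀ with h | h
  · exact ⟨fun w ↦ Complex.arg (w : ℂ), {w : Circle | (w : ℂ) ∈ Complex.slitPlane},
      Complex.isOpen_slitPlane.preimage contMDiff_coe_circle.continuous, h,
      fun w hw ↦ (contMDiffAt_arg_circle hw).contMDiffWithinAt, Circle.exp_arg⟩
  · exact ⟨fun w ↦ Complex.arg (-(w : ℂ)) + π, {w : Circle | -(w : ℂ) ∈ Complex.slitPlane},
      Complex.isOpen_slitPlane.preimage contMDiff_coe_circle.continuous.neg, h,
      fun w hw ↦ (contMDiffAt_arg_neg_circle hw).contMDiffWithinAt, circleExp_arg_neg_add_pi⟩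

/-- **Shear straightening of the sphere over a tube about the dual circle.**  Let
`e : Sⁿ → S¹ × Sⁿ` be a smooth embedding meeting the fibre circle `S¹ × {p₀}` only at `e x₀`, with
`d(pr₂ ∘ e)_{x₀}` injective (transversal crossing).  Then there are a fibre-preserving
diffeomorphism `Θ` of `S¹ × Sⁿ` (a shear `(z, p) ↦ (z · k(p)⁻¹, p)`) and `r > 0` such that the
sphere `Θ(e(Sⁿ))` meets the closed tube `S¹ × B̄(p₀, r)` exactly in the flat `n`-disc
`{1} × B̄(p₀, r)`; in particular `Θ (e x₀) = (1, p₀)`.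
[cite: BudneyGabai2019, proof of Thm. 3.13; HirschDT1976, Ch. 2 §2] -/
theorem exists_shear_straightening
    {e : Metric.sphere (0 : EuclideanSpace ℝ (Fin (n + 1))) 1 →
      Circle × Metric.sphere (0 : EuclideanSpace ℝ (Fin (n + 1))) 1}
    (he : Manifold.IsSmoothEmbedding (𝓡 n) ((𝓡 1).prod (𝓡 n)) ∞ e)
    {x₀ p₀ : Metric.sphere (0 : EuclideanSpace ℝ (Fin (n + 1))) 1} (hx₀ : (e x₀).2 = p₀)
    (hcross : ∀ x, (e x).2 = p₀ → x = x₀)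
    (hinj : Injective (mfderiv (𝓡 n) (𝓡 n)
      (fun x ↦ (e x).2 : Metric.sphere (0 : EuclideanSpace ℝ (Fin (n + 1))) 1 →
        Metric.sphere (0 : EuclideanSpace ℝ (Fin (n + 1))) 1) x₀)) :
    ∃ (Θ : (Circle × Metric.sphere (0 : EuclideanSpace ℝ (Fin (n + 1))) 1) ≃ₘ⟮(𝓡 1).prod (𝓡 n),
        (𝓡 1).prod (𝓡 n)⟯ (Circle × Metric.sphere (0 : EuclideanSpace ℝ (Fin (n + 1))) 1))
      (r : ℝ), 0 < r ∧ (∀ q, (Θ q).2 = q.2) ∧ Θ (e x₀) = (1, p₀) ∧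
      range (Θ ∘ e) ∩ {q | q.2 ∈ closedBall p₀ r} = {(1 : Circle)} ×ˢ closedBall p₀ r := by
  obtain ⟨r₁, σ, hr₁, hσs, hσ₀, hright, hleft⟩ := exists_localInverse_snd_comp he hx₀ hcross hinj
  -- the graph function `g = pr₁ ∘ e ∘ σ`, smooth on `B(p₀, r₁)`
  set g : Metric.sphere (0 : EuclideanSpace ℝ (Fin (n + 1))) 1 → Circle := fun p ↦ (e (σ p)).1
    with hg
  have hgs : ContMDiffOn (𝓡 n) (𝓡 1) ∞ g (ball p₀ r₁) :=
    (contMDiff_fst.comp he.contMDiff).comp_contMDiffOn hσs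
  -- a local angle for `g` near `p₀`
  obtain ⟨A, U, hUo, hU₀, hAs, hAexp⟩ := exists_angle_contMDiffOn (g p₀)
  have hVo : IsOpen (ball p₀ r₁ ∩ g ⁻¹' U) := hgs.continuousOn.isOpen_inter_preimage isOpen_ball hUo
  have hp₀V : p₀ ∈ ball p₀ r₁ ∩ g ⁻¹' U := ⟨mem_ball_self hr₁, hU₀⟩
  obtain ⟨r₃, hr₃, hr₃V⟩ := Metric.isOpen_iff.1 hVo p₀ hp₀V
  have hfs : ContMDiffOn (𝓡 n) 𝓘(ℝ, ℝ) ∞ (fun p ↦ A (g p)) (ball p₀ r₁ ∩ g ⁻¹' U) :=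
    hAs.comp (hgs.mono inter_subset_left) fun p hp ↦ hp.2
  -- a bump function: `χ = 1` on `B̄(p₀, r₃/4)`, `χ = 0` off `B(p₀, r₃/2)`
  have hdisj : Disjoint (ball p₀ (r₃ / 2))ᶜ (closedBall p₀ (r₃ / 4)) :=
    disjoint_compl_left_iff.2 (closedBall_subset_ball (by linarith))
  obtain ⟨χ, hχ0, hχ1, -⟩ := exists_contMDiffMap_zero_one_of_isClosed (𝓡 n)
    (isOpen_ball.isClosed_compl) isClosed_closedBall hdisj (n := ⊤)
  -- the extension `k = exp (χ · A ∘ g)` of `g` from `B̄(p₀, r₃/4)` to `Sⁿ`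
  set F : Metric.sphere (0 : EuclideanSpace ℝ (Fin (n + 1))) 1 → ℝ := fun p ↦ χ p * A (g p)
    with hF
  have hFs : ContMDiff (𝓡 n) 𝓘(ℝ, ℝ) ∞ F := by
    refine contMDiff_of_tsupport fun p hp ↦ ?_
    have hsupp : tsupport F ⊆ closedBall p₀ (r₃ / 2) := by
      refine closure_minimal ?_ isClosed_closedBall
      intro q hq
      by_contra hq'
      apply hq
      have hχq : χ q = 0 := hχ0 (fun h ↦ hq' (ball_subset_closedBall h))
      simp [hF, hχq]
    have hpV : p ∈ ball p₀ r₁ ∩ g ⁻¹' U :=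
      hr₃V (closedBall_subset_ball (by linarith) (hsupp hp))
    exact χ.contMDiff.contMDiffAt.mul (hfs.contMDiffAt (hVo.mem_nhds hpV))
  set k : Metric.sphere (0 : EuclideanSpace ℝ (Fin (n + 1))) 1 → Circle := fun p ↦ Circle.exp (F p)
    with hk
  have hks : ContMDiff (𝓡 n) (𝓡 1) ∞ k := contMDiff_circleExp.comp hFs
  have hkg : ∀ p ∈ closedBall p₀ (r₃ / 4), k p = g p := fun p hp ↦ by
    have hχp : χ p = 1 := hχ1 hp
    simp only [hk, hF, hχp, one_mul]
    exact hAexp _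
  -- the shear
  let Θ : (Circle × Metric.sphere (0 : EuclideanSpace ℝ (Fin (n + 1))) 1) ≃ₘ⟮(𝓡 1).prod (𝓡 n),
      (𝓡 1).prod (𝓡 n)⟯ (Circle × Metric.sphere (0 : EuclideanSpace ℝ (Fin (n + 1))) 1) :=
    { toFun := fun q ↦ (q.1 * (k q.2)⁻¹, q.2)
      invFun := fun q ↦ (q.1 * k q.2, q.2)
      left_inv := fun q ↦ Prod.ext (inv_mul_cancel_right q.1 (k q.2)) rfl
      right_inv := fun q ↦ Prod.ext (mul_inv_cancel_right q.1 (k q.2)) rfl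
      contMDiff_toFun := (contMDiff_fst.mul (hks.comp contMDiff_snd).inv).prodMk contMDiff_snd
      contMDiff_invFun := (contMDiff_fst.mul (hks.comp contMDiff_snd)).prodMk contMDiff_snd }
  have hΘ : ∀ q, Θ q = (q.1 * (k q.2)⁻¹, q.2) := fun q ↦ rfl
  -- radii: `B̄(p₀, r₃/4) ⊆ B(p₀, r₃) ⊆ B(p₀, r₁)`
  have hsub : closedBall p₀ (r₃ / 4) ⊆ ball p₀ r₁ := fun p hp ↦
    (hr₃V (closedBall_subset_ball (by linarith) hp)).1
  have hgraph : ∀ p ∈ closedBall p₀ (r₃ / 4), Θ (e (σ p)) = (1, p) := fun p hp ↦ by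
    rw [hΘ, hright p (hsub hp), hkg p hp]
    exact Prod.ext (mul_inv_cancel (g p)) rfl
  refine ⟨Θ, r₃ / 4, by linarith, fun q ↦ rfl, ?_, ?_⟩
  · have h := hgraph p₀ (mem_closedBall_self (by linarith))
    rwa [hσ₀] at h
  · ext q
    constructor
    · rintro ⟨⟨x, rfl⟩, hq⟩
      have hq' : (e x).2 ∈ closedBall p₀ (r₃ / 4) := hq
      have hx : x = σ (e x).2 := hleft x (hsub hq')
      have key : Θ (e x) = (1, (e x).2) := by
        conv_lhs => rw [hx]
        exact hgraph _ hq'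
      show Θ (e x) ∈ _
      rw [key]
      exact ⟨rfl, hq'⟩
    · rintro ⟨hq1, hq2⟩
      have hq1 : q.1 = 1 := hq1
      refine ⟨⟨σ q.2, ?_⟩, hq2⟩
      show Θ (e (σ q.2)) = q
      rw [hgraph _ hq2]
      exact Prod.ext hq1.symm rfl

end BudneyGabai2019_thm_3_13

end Literature.Topology.FourManifolds

end
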